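import Mathlib
import Literature.NumberTheory.Transcendental.GammaIsoCross
import Literature.NumberTheory.Transcendental.ZilberFieldSaturationMain
import Literature.FieldTheory.Kummer.DivisionSequencesProofs

/-!
# Stub `stub_logShift` (line `eac-extends-core-automorphisms`, crux stmt-Schanuel-0968)

**Logarithms shift by kernel multiples (Kummer).** Let `F` be an exponential field with
`ker exp = τℤ`, `X = ℚτ + ℚc` for a finite tuple `c`, and `d ∈ F` with `exp d` algebraic over the
Γ-field `ℚ(gens X) = ℚ(X, exp X)` but `d` not. Then there is `m ≥ 1` such that for EVERY `j ∈ ℤ`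
the assignment `(c, d) ↦ (c, d + m j τ)` is a Γ-isomorphism over `ℚτ`
(`GammaField.IsGammaIso`, all Kummer levels at once): `logShift_isGammaIso`. Specialised to
`ℂ`, `τ = 2πi`, and restated as a cross Γ-isomorphism over the identity of `ℚ^{ab}(2πi)`
(`GammaField.IsGammaIsoTw₂ (RingEquiv.refl _)`), this is the registered stub `stub_logShift` of
the reshaped line `eac-extends-core-automorphisms` of crux
`Summit.Schanuel.Schanuel.Theses.RigidCore.AclSubsetLogFreeCore` (stmt-Schanuel-0968).

Proof (Bays–Kirby 2018, proof of Lemma 8.3 / Prop. 3.22, "all division sequences of a good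
division point have the same type"; Kirby 2013, Fact 3.7). Let `u` be a basis of `X` modulo `ℚτ`
(`ZilberSaturationMain.exists_linIndepOver_comp`); since `d ∉ X`, `(exp u, exp d)` is
multiplicatively independent modulo roots of unity (`ZilberSaturationMain.mulIndepModTorsion_exp`),
so the PROVED Kummer fact `Literature.FieldTheory.Kummer.BaysKirby2018_divisionSequences_determined_holds`
(with `S = {τ} ∪ c`, `b = exp u`, `c₀ = exp d`) gives `m ≥ 1` such that below the `m`-th root
`exp (d/m)` of `exp d` all division systems have the same relation ideal over
`L = ℚ(μ_∞, S, exp (d/m), √(exp u))`. The two division systems `ρ_k = exp (d/(mk))` and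
`σ_k = exp ((d + mjτ)/(mk))` (both below `exp (d/m)`, as `exp (jτ) = 1`) therefore satisfy the same
polynomial relations over `L`; since `d` and `d + mjτ` are transcendental over `L[ρ]`, `L[σ]`
(everything there is algebraic over `ℚ(gens X)`, `d` is not), so do `(d, ρ)` and `(d + mjτ, σ)`
(`ZilberHomogeneity.ker_aeval_sumElim_eq`), whence a field embedding
`Ξ : L(d, ρ) → F` over `L` with `d ↦ d + mjτ`, `ρ_k ↦ σ_k` (`GammaField.pointFieldHom`). The field
`L(d, ρ)` contains the Γ-field `⟨ℚτ, (c, d)⟩`; `Ξ` fixes `ℚ(gens X) ⊆ L`, sends `d ↦ d + mjτ` and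
commutes with `exp` on `X + ℚd` (`exp (q d) = ρ_{den q}^{m num q} ↦ σ_{den q}^{m num q} =
exp (q (d + mjτ))`), so `GammaField.isGammaIso_of_ringHom` applies. The shift is by `m·j·τ` with
`m` from the Kummer fact, never by `τ` itself (Kummer parity of the branches of `log 2`).

## References

* M. Bays, J. Kirby, *Pseudo-exponential maps, variants, and quasiminimality*, Algebra & Number
  Theory 12 (2018) 493–549: Def. 3.10, Prop. 3.22, Lemma 8.3 (proof).
* J. Kirby, *Finitely presented exponential fields*, Algebra & Number Theory 7 (2013): Fact 3.7.
-/

noncomputable section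

-- the namespace `Summit.Schanuel.Schanuel.…` (problem = summit, D-0022) trips the duplicated-namespace
-- linter on every declaration; the project lakefile disables it for the same reason.
set_option linter.dupNamespace false

open Set
open Literature.ModelTheory.ExponentialFields Literature.ModelTheory.ExponentialFields.ExponentialRing
open Literature.NumberTheory.Transcendental Literature.NumberTheory.Transcendental.GammaField

universe u

namespace Summit.Schanuel.Schanuel.Theorems.RigidCore

open ZilberSaturationMain ZilberHomogeneity Literature.FieldTheory.Kummer MvPolynomial

/-- **Logarithms of algebraic elements shift by kernel multiples** (Bays–Kirby 2018, proof of
Lemma 8.3 with Prop. 3.22; Kirby 2013, Fact 3.7). In an exponential field `F` with `ker exp = τℤ`,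
let `X = ℚτ + ℚc` and let `d` be such that `exp d` is algebraic over `ℚ(gens X)` while `d` is not.
Then there is `m ≥ 1` such that for every `j ∈ ℤ`, `(c, d) ↦ (c, d + m j τ)` is a Γ-isomorphism
over `ℚτ`. [cite: BaysKirby2018ANT, Lemma 8.3 (proof), Prop. 3.22] -/
theorem logShift_isGammaIso {F : Type u} [Field F] [CharZero F] [ExponentialRing F] {τ : F}
    (hker : expKernel F = AddSubgroup.zmultiples τ) {N : ℕ} (c : Fin N → F) (d : F)
    (hexp : exp d ∈ acl (gens (Submodule.span ℚ ({τ} : Set F) ⊔ Submodule.span ℚ (range c))))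
    (hd : d ∉ acl (gens (Submodule.span ℚ ({τ} : Set F) ⊔ Submodule.span ℚ (range c)))) :
    ∃ m : ℕ, 0 < m ∧ ∀ j : ℤ,
      IsGammaIso (Submodule.span ℚ ({τ} : Set F)) (Fin.snoc c d)
        (Fin.snoc c (d + (m : F) * (j : F) * τ)) := by
  classical
  set Λ₀ : Submodule ℚ F := Submodule.span ℚ {τ} with hΛ₀
  set X := Λ₀ ⊔ Submodule.span ℚ (range c) with hXdef
  have hτX : τ ∈ X := Submodule.mem_sup_left (Submodule.subset_span rfl)
  have hXacl : (X : Set F) ⊆ acl (gens X) := fun y hy => subset_acl _ (mem_gens_of_mem hy)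
  have hdX : d ∉ X := fun h => hd (hXacl h)
  -- Step 1: a basis `u = c ∘ σ` of `X` modulo `ℚτ`
  obtain ⟨r, σ, hu, hspan⟩ := exists_linIndepOver_comp Λ₀ c
  set u : Fin r → F := c ∘ σ with hudef
  have hXu : X = Λ₀ ⊔ Submodule.span ℚ (range u) := by rw [hXdef, ← hspan]
  have huX : ∀ l, u l ∈ X := fun l => by
    rw [hXu]; exact Submodule.mem_sup_right (Submodule.subset_span ⟨l, rfl⟩)
  have hud : LinIndepOver Λ₀ (Fin.append u ![d]) := hu.append_single (by rwa [← hXu])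
  -- Step 2: the Kummer fact
  set S : Set F := {τ} ∪ range c with hSdef
  have hSfin : S.Finite := (finite_singleton τ).union (finite_range c)
  set b : Fin r → F := fun l => exp (u l) with hbdef
  set cK : Fin 1 → F := fun i => exp ((![d] : Fin 1 → F) i) with hcK
  have hb0 : ∀ l, b l ≠ 0 := fun l => exp_ne_zero _
  have hc0 : ∀ i, cK i ≠ 0 := fun i => exp_ne_zero _
  have hind : MulIndepModTorsion (Fin.append b cK) := by
    have : Fin.append b cK = fun i => exp (Fin.append u ![d] i) := by
      rw [comp_append]; rfl
    rw [this]
    exact mulIndepModTorsion_exp hker hud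
  obtain ⟨m, hm, H⟩ := BaysKirby2018_divisionSequences_determined_holds S hSfin b cK hb0 hc0 hind
  refine ⟨m, hm, fun j => ?_⟩
  have hm0 : (m : F) ≠ 0 := Nat.cast_ne_zero.2 hm.ne'
  set d' : F := d + (m : F) * (j : F) * τ with hd'def
  have hmjτ : (m : F) * (j : F) * τ ∈ X := by
    have := X.smul_of_tower_mem m (X.smul_of_tower_mem j hτX)
    rwa [zsmul_eq_mul, nsmul_eq_mul, ← mul_assoc] at this
  have hd'acl : d' ∉ acl (gens X) := by
    intro h
    apply hd
    have : d = d' + -((m : F) * (j : F) * τ) := by rw [hd'def]; ring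
    rw [this]
    exact add_mem_acl h (neg_mem_acl (hXacl hmjτ))
  -- Step 3: the `m`-th root `exp (d/m)` and the two division systems below it
  set a : Fin 1 → F := fun _ => d / (m : F) with hadef
  set a' : Fin 1 → F := fun _ => d' / (m : F) with ha'def
  have hc' : ∀ i, expTuple a i ^ m = cK i := by
    intro i
    simp only [expTuple, hadef, hcK, Matrix.cons_val_fin_one]
    rw [← exp_nsmul, nsmul_eq_mul, mul_div_cancel₀ _ hm0]
  have hdiv : d' / (m : F) = d / (m : F) + (j : F) * τ := by
    rw [hd'def]; field_simp
  have hexpd' : exp (d' / (m : F)) = exp (d / (m : F)) := by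
    rw [hdiv, exp_add, ← zsmul_eq_mul, exp_zsmul, exp_tau_eq_one hker, one_zpow, mul_one]
  have hσsys : IsDivisionSystem
      (fun i => algebraMap (baseField (S ∪ range (expTuple a)) b) F (baseTuple S b (expTuple a) i))
      (rho a') := by
    refine ⟨?_, (isDivisionSystem_rho a').2⟩
    funext i
    change exp (a' i / (((1 : ℕ+) : ℕ) : F)) = exp (a i)
    simp only [ha'def, hadef, PNat.one_coe, Nat.cast_one, div_one]
    exact hexpd'
  have hkerEq := H (expTuple a) hc' (rho a) (isDivisionSystem_rho a) F (rho a') hσsys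
  set L := baseField (S ∪ range (expTuple a)) b with hLdef
  set v : ℕ+ × Fin 1 → F := fun p => rho a p.1 p.2 with hvdef
  set w : ℕ+ × Fin 1 → F := fun p => rho a' p.1 p.2 with hwdef
  -- Step 4: everything in sight is algebraic over `ℚ(gens X)`, except `d` and `d'`
  have hexp_dm : exp (d / (m : F)) ∈ acl (gens X) := by
    rw [div_natCast_eq_smul]; exact exp_smul_mem_acl _ hexp
  have hv_acl : range v ⊆ acl (gens X) := by
    rintro _ ⟨p, rfl⟩
    simp only [hvdef, rho, hadef]
    rw [div_natCast_eq_smul]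
    exact exp_smul_mem_acl _ hexp_dm
  have hw_acl : range w ⊆ acl (gens X) := by
    rintro _ ⟨p, rfl⟩
    simp only [hwdef, rho, ha'def]
    rw [div_natCast_eq_smul]
    exact exp_smul_mem_acl _ (hexpd' ▸ hexp_dm)
  have hLsub : (L : Set F) ⊆ acl (gens X) := by
    refine (subfieldClosure_subset_acl _).trans (acl_subset_acl_of_subset ?_)
    rintro y ((⟨k, hk, hy⟩ | hy) | hy)
    · exact mem_acl_of_pow_mem hk.ne' (by rw [hy]; exact one_mem_acl _)
    · rcases hy with (hy | ⟨i, rfl⟩) | ⟨i, rfl⟩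
      · rw [mem_singleton_iff.1 hy]; exact hXacl hτX
      · exact hXacl (Submodule.mem_sup_right (Submodule.subset_span ⟨i, rfl⟩))
      · exact hexp_dm
    · obtain ⟨l, k, hk, hy⟩ := mem_iUnion.1 hy
      exact mem_acl_of_pow_mem hk.ne' (by rw [hy]; exact subset_acl _ (exp_mem_gens (huX l)))
  have hLacl : ∀ y : L, algebraMap L F y ∈ acl (gens X) := fun y => hLsub y.2
  have hp : AlgebraicIndependent (Algebra.adjoin L (range v)) ![d] := by
    rw [algebraicIndependent_iff_transcendental]
    exact transcendental_of_not_mem_acl _ (algebraAdjoin_subset_acl hLacl hv_acl) hd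
  have hq : AlgebraicIndependent (Algebra.adjoin L (range w)) ![d'] := by
    rw [algebraicIndependent_iff_transcendental]
    exact transcendental_of_not_mem_acl _ (algebraAdjoin_subset_acl hLacl hw_acl) hd'acl
  have hker2 := ker_aeval_sumElim_eq hkerEq hp hq
  -- Step 5: the field embedding `L(d, exp (d/(mk)) : k) → F`, `d ↦ d'`, `exp (d/(mk)) ↦ exp (d'/(mk))`
  set V : Fin 1 ⊕ (ℕ+ × Fin 1) → F := Sum.elim ![d] v with hVdef
  set W : Fin 1 ⊕ (ℕ+ × Fin 1) → F := Sum.elim ![d'] w with hWdef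
  have hiff : ∀ P : MvPolynomial (Fin 1 ⊕ (ℕ+ × Fin 1)) L,
      aeval V P = 0 ↔ eval₂ (algebraMap L F) W P = 0 := fun P => by
    have h := SetLike.ext_iff.1 hker2 P
    rwa [RingHom.mem_ker, RingHom.mem_ker] at h
  set E : IntermediateField L F := IntermediateField.adjoin L (range V) with hE
  let Ξ := pointFieldHom (algebraMap L F) V W hiff
  have hΞL : ∀ y : L, Ξ (algebraMap L E y) = (y : F) := pointFieldHom_algebraMap _ V W hiff
  have hΞV : ∀ i, Ξ ⟨V i, IntermediateField.subset_adjoin L _ ⟨i, rfl⟩⟩ = W i :=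
    fun i => pointFieldHom_apply_self _ V W hiff i
  -- Step 6: membership in `L` and in `E = L(d, exp (d/(mk)) : k)`
  have hS_L : S ⊆ L := fun y hy => mem_baseField_of_mem _ (Or.inl hy)
  have hX_L : (X : Set F) ⊆ L := by
    intro y hy
    have hy' : y ∈ Submodule.span ℚ S := by rwa [hSdef, Submodule.span_union]
    exact mem_subfield_of_mem_span hS_L hy'
  have hrootsL : ∀ k : ℕ, 0 < k → exp (τ / (k : F)) ∈ L := by
    intro k hk
    refine mem_baseField_of_mem_allRoots_one _ ⟨k, hk, ?_⟩
    rw [← exp_nsmul, nsmul_eq_mul, mul_div_cancel₀ _ (Nat.cast_ne_zero.2 hk.ne'),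
      exp_tau_eq_one hker]
  have hurootsL : ∀ (l : Fin r) (k : ℕ), 0 < k → exp (u l / (k : F)) ∈ L := by
    intro l k hk
    refine mem_baseField_of_mem_allRoots _ l ⟨k, hk, ?_⟩
    rw [← exp_nsmul, nsmul_eq_mul, mul_div_cancel₀ _ (Nat.cast_ne_zero.2 hk.ne')]
  have hexpX_L : ∀ y ∈ X, exp y ∈ L := by
    intro y hy
    rw [hXu] at hy
    obtain ⟨y₀, hy₀, y₁, hy₁, rfl⟩ := Submodule.mem_sup.1 hy
    rw [exp_add]
    refine mul_mem ?_ (exp_mem_of_mem_span hurootsL hy₁)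
    have hy₀' : y₀ ∈ Submodule.span ℚ (range ![τ]) := by simpa using hy₀
    exact exp_mem_of_mem_span (w := ![τ]) (fun i k hk => by simpa using hrootsL k hk) hy₀'
  have hgensX_L : gens X ⊆ L := by
    rintro y (hy | ⟨x, hx, rfl⟩)
    · exact hX_L hy
    · exact hexpX_L x hx
  have hLE : ∀ y ∈ L, y ∈ E := fun y hy => E.algebraMap_mem ⟨y, hy⟩
  have hdE : d ∈ E := IntermediateField.subset_adjoin L _ ⟨Sum.inl 0, rfl⟩
  have hvE : ∀ p, v p ∈ E := fun p => IntermediateField.subset_adjoin L _ ⟨Sum.inr p, rfl⟩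
  have hexp_qd : ∀ q : ℚ, exp (q • d) = v (⟨q.den, q.den_pos⟩, 0) ^ ((m : ℤ) * q.num) := by
    intro q
    rw [exp_rat_smul_eq_zpow_den, zpow_mul]
    congr 1
    simp only [hvdef, rho, hadef, PNat.mk_coe, zpow_natCast]
    rw [← exp_nsmul, nsmul_eq_mul]
    congr 1
    field_simp
  have hexp_qd' : ∀ q : ℚ, exp (q • d') = w (⟨q.den, q.den_pos⟩, 0) ^ ((m : ℤ) * q.num) := by
    intro q
    rw [exp_rat_smul_eq_zpow_den, zpow_mul]
    congr 1
    simp only [hwdef, rho, ha'def, PNat.mk_coe, zpow_natCast]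
    rw [← exp_nsmul, nsmul_eq_mul]
    congr 1
    field_simp
  have hYeq : Λ₀ ⊔ Submodule.span ℚ (range (Fin.snoc c d)) = X ⊔ Submodule.span ℚ {d} := by
    rw [Fin.range_snoc, Submodule.span_insert, sup_left_comm, sup_comm, hXdef]
  have hYE : ∀ y ∈ X ⊔ Submodule.span ℚ {d}, y ∈ E ∧ exp y ∈ E := by
    intro y hy
    obtain ⟨x₀, hx₀, z, hz, rfl⟩ := Submodule.mem_sup.1 hy
    obtain ⟨q, rfl⟩ := Submodule.mem_span_singleton.1 hz
    refine ⟨add_mem (hLE _ (hX_L hx₀)) ?_, ?_⟩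
    · rw [Rat.smul_def]; exact mul_mem (hLE _ (SubfieldClass.ratCast_mem L q)) hdE
    · rw [exp_add, hexp_qd]; exact mul_mem (hLE _ (hexpX_L x₀ hx₀)) (zpow_mem (hvE _) _)
  -- Step 7: the values of `Ξ`
  have hΞfix : ∀ (y : F) (hy : y ∈ L) (h : y ∈ E), Ξ ⟨y, h⟩ = y := by
    intro y hy h
    have e : (⟨y, h⟩ : E) = algebraMap L E ⟨y, hy⟩ := Subtype.ext rfl
    rw [e, hΞL]
  have hΞd : ∀ h : d ∈ E, Ξ ⟨d, h⟩ = d' := by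
    intro h
    have e : (⟨d, h⟩ : E) = ⟨V (Sum.inl 0), IntermediateField.subset_adjoin L _ ⟨Sum.inl 0, rfl⟩⟩ :=
      Subtype.ext rfl
    rw [e, hΞV]; rfl
  have hΞv : ∀ (p) (h : v p ∈ E), Ξ ⟨v p, h⟩ = w p := by
    intro p h
    have e : (⟨v p, h⟩ : E) = ⟨V (Sum.inr p), IntermediateField.subset_adjoin L _ ⟨Sum.inr p, rfl⟩⟩ :=
      Subtype.ext rfl
    rw [e, hΞV]; rfl
  have hΞexp : ∀ y ∈ X ⊔ Submodule.span ℚ {d}, ∀ (h : y ∈ E) (h' : exp y ∈ E),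
      Ξ ⟨exp y, h'⟩ = exp (Ξ ⟨y, h⟩) := by
    intro y hy h h'
    obtain ⟨x₀, hx₀, z, hz, rfl⟩ := Submodule.mem_sup.1 hy
    obtain ⟨q, rfl⟩ := Submodule.mem_span_singleton.1 hz
    have hΞexpqd : Ξ ⟨exp (q • d), (hexp_qd q).symm ▸ zpow_mem (hvE _) _⟩ = exp (q • d') := by
      have e : (⟨exp (q • d), (hexp_qd q).symm ▸ zpow_mem (hvE _) _⟩ : E) =
          ⟨v (⟨q.den, q.den_pos⟩, 0), hvE _⟩ ^ ((m : ℤ) * q.num) :=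
        Subtype.ext (by push_cast; exact hexp_qd q)
      rw [e, map_zpow₀, hΞv, ← hexp_qd']
    have e1 : (⟨x₀ + q • d, h⟩ : E) = ⟨x₀, hLE _ (hX_L hx₀)⟩ + ((q : ℚ) : E) * ⟨d, hdE⟩ :=
      Subtype.ext (by push_cast; rw [Rat.smul_def])
    have e2 : (⟨exp (x₀ + q • d), h'⟩ : E) =
        ⟨exp x₀, hLE _ (hexpX_L x₀ hx₀)⟩ * ⟨exp (q • d), (hexp_qd q).symm ▸ zpow_mem (hvE _) _⟩ :=
      Subtype.ext (by push_cast; rw [exp_add])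
    rw [e1, e2, map_mul, map_add, map_mul, map_ratCast, hΞfix _ (hX_L hx₀),
      hΞfix _ (hexpX_L x₀ hx₀), hΞd, hΞexpqd, exp_add, Rat.smul_def]
  -- Step 8: restrict to the Γ-field `⟨ℚτ, (c, d)⟩ = K₀(allGens (c, d))` and conclude
  set E₂ : IntermediateField (fieldOf Λ₀) F :=
    IntermediateField.adjoin (fieldOf Λ₀) (allGens (Fin.snoc c d)) with hE₂
  have hE₂E : ∀ y ∈ E₂, y ∈ E := by
    intro y hy
    have hy' : y ∈ fieldOf (X ⊔ Submodule.span ℚ {d}) := by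
      rw [← hYeq]; exact (mem_adjoinField_allGens_iff Λ₀ (Fin.snoc c d)).1 hy
    refine fieldOf_subset_of_gens_subset (L := E.toSubfield) ?_ hy'
    rintro z (hz | ⟨x, hx, rfl⟩)
    · exact (hYE z hz).1
    · exact (hYE x hx).2
  let Θ : E₂ →+* F :=
    { toFun := fun y => Ξ ⟨y.1, hE₂E y.1 y.2⟩
      map_one' := Ξ.map_one
      map_mul' := fun y y' => Ξ.map_mul ⟨y.1, hE₂E y.1 y.2⟩ ⟨y'.1, hE₂E y'.1 y'.2⟩
      map_zero' := Ξ.map_zero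
      map_add' := fun y y' => Ξ.map_add ⟨y.1, hE₂E y.1 y.2⟩ ⟨y'.1, hE₂E y'.1 y'.2⟩ }
  have hΘ : ∀ (y : F) (hy : y ∈ E₂), Θ ⟨y, hy⟩ = Ξ ⟨y, hE₂E y hy⟩ := fun _ _ => rfl
  refine isGammaIso_of_ringHom Θ (fun k => ?_) (fun i => ?_) (fun y hy => ?_)
  · -- identity on `K₀ = ℚ(ℚτ, exp ℚτ)`
    rw [hΘ]
    exact hΞfix _ (fieldOf_subset_of_gens_subset (L := L)
      (fun y hy => hgensX_L (gens_mono le_sup_left hy)) k.2) _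
  · -- generators: `cᵢ ↦ cᵢ`, `d ↦ d'`
    rw [hΘ]
    revert i
    refine Fin.lastCases ?_ (fun i => ?_)
    · have e : ∀ h : (Fin.snoc c d : Fin (N + 1) → F) (Fin.last N) ∈ E,
          (⟨(Fin.snoc c d : Fin (N + 1) → F) (Fin.last N), h⟩ : E) = ⟨d, hdE⟩ :=
        fun h => Subtype.ext (by simp)
      rw [e, hΞd, Fin.snoc_last]
    · have hci : c i ∈ L := hS_L (Or.inr ⟨i, rfl⟩)
      have e : ∀ h : (Fin.snoc c d : Fin (N + 1) → F) (Fin.castSucc i) ∈ E,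
          (⟨(Fin.snoc c d : Fin (N + 1) → F) (Fin.castSucc i), h⟩ : E) = ⟨c i, hLE _ hci⟩ :=
        fun h => Subtype.ext (by simp)
      rw [e, hΞfix _ hci, Fin.snoc_castSucc]
  · -- compatibility with `exp` on `ℚτ + ℚ(c, d) = X + ℚd`
    rw [hΘ, hΘ]
    rw [hYeq] at hy
    exact hΞexp y hy _ _

/-- The kernel of the complex exponential is `2πiℤ` (tree vocabulary:
`ExponentialRing.expKernel`, from `mem_expKernel_complex_iff`). [folklore] -/
theorem logShift_expKernel_complex :
    expKernel ℂ = AddSubgroup.zmultiples (2 * ↑Real.pi * Complex.I : ℂ) := by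
  ext x
  rw [mem_expKernel_complex_iff, AddSubgroup.mem_zmultiples_iff]
  constructor
  · rintro ⟨n, hn⟩
    exact ⟨n, by rw [hn, zsmul_eq_mul]⟩
  · rintro ⟨n, rfl⟩
    exact ⟨n, by rw [zsmul_eq_mul]⟩

/-- **Stub `stub_logShift` — logarithms shift (Kummer).** If `exp d` is algebraic over the Γ-field
`ℚ(2πiℚ, c, exp(ℚ·2πi + ℚc))` of `Λ₀ + ℚc` (`Λ₀ = ℚ·2πi`) but `d` is not, then for some `m ≥ 1` and
EVERY `j ∈ ℤ`, `(c, d) ↦ (c, d + m j·2πi)` is a Γ-isomorphism over the identity of `ℚ^{ab}(2πi)`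
(all Kummer levels at once), stated over a variable `τ = 2πi`. From `logShift_isGammaIso` (the
Kummer fact `BaysKirby2018_divisionSequences_determined_holds`) and
`GammaField.isGammaIsoTw₂_iff_isGammaIsoTw`. [cite: BaysKirby2018ANT, Lemma 8.3 (proof), Prop. 3.22] -/
theorem stub_logShift (τ : ℂ) (hτ : τ = 2 * ↑Real.pi * Complex.I) {N : ℕ} (c : Fin N → ℂ) (d : ℂ)
    (hexp : Complex.exp d ∈ acl (gens (Submodule.span ℚ ({τ} : Set ℂ) ⊔
      Submodule.span ℚ (range c))))
    (hd : d ∉ acl (gens (Submodule.span ℚ ({τ} : Set ℂ) ⊔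
      Submodule.span ℚ (range c)))) :
    ∃ m : ℕ, 0 < m ∧ ∀ j : ℤ,
      IsGammaIsoTw₂ (RingEquiv.refl (fieldOf (Submodule.span ℚ ({τ} : Set ℂ))))
        (Fin.snoc c d) (Fin.snoc c (d + (m : ℂ) * (j : ℂ) * τ)) := by
  have hker : expKernel ℂ = AddSubgroup.zmultiples τ := by
    rw [hτ]; exact logShift_expKernel_complex
  obtain ⟨m, hm, h⟩ := logShift_isGammaIso hker c d hexp hd
  exact ⟨m, hm, fun j => isGammaIsoTw₂_iff_isGammaIsoTw.2 (h j).isGammaIsoTw_refl⟩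

end Summit.Schanuel.Schanuel.Theorems.RigidCore
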